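import Literature.NumberTheory.Automorphic.UnitaryGroupCotangentSpectralProjection
import Literature.NumberTheory.Automorphic.UnitaryGroupCongruenceLevels
import Summits.HodgeConjecture.HodgeConjecture.Theorems.H413SpectrumJunction
import Summits.HodgeConjecture.HodgeConjecture.Theorems.F0P2aStubS1SesqSchur
import Mathlib.Analysis.InnerProductSpace.PiL2
import HarnessLib

/-!
# F0-P2a · line 2 CLOSED BY NAME — I: the ORTHOGONALITY BOOTSTRAP (generic unitary datum), Theorems-side port (lead p01)

Cell hodgecm-mathlib, FLOOR 0; crux `H413` = `stmt-HodgeConjecture-24833`; line `Cruxes/H413/Lines/F0_P2aCohIsotypicLine.lean` (F0P2a-plan g2/g3,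
all five stubs ★ since ed. 4).  THEOREMS ONLY (no `def`, no `sorry`); `--supports stmt-HodgeConjecture-24833 --as helper`.  This is §3 of the line
file ported to an IMPORTABLE Theorems module (a `Cruxes/…/Lines` file is never imported): `inner_rightRegular_rightRegular`,
`containsForm_sub_smul`, `exists_clsMaps` (linear `σ`-equivariant coordinate class maps into `P`), and THE BOOTSTRAP
`exists_eq_smul_of_orthVanish` — with S1 (Schur for invariant sesquilinear forms) DISCHARGED by ★ `F0P2aStubS1SesqSchur.stubS1_holds` (F0P2a-p04)
and the orthogonality-vanishing property of the carrier `A` written out as a hypothesis (the line's `OrthVanish A P`, def-free).  Part II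
(`F0P2aCohIsotypicLineHolds`) instantiates it at the holomorphic / antiholomorphic cotangent forms of the CM factor and concludes the (E) letters
★ `CotangentForms.cohIsotypicLine_hol / _antihol` BY NAME.  HC_CM is proved only modulo the printed citations until rung 0 closes.

## References
* [Liu2021] Y. Liu, arXiv:2106.08732, App. D, Lem. D.2 (2).  [BorelWallach2000] VI 4.11, VII 2.10/3.2.  [BorelJacquet1979] Corvallis §4.2, §4.6.
* [BernsteinZelevinsky1976] §2; [Bump1997] Prop. 4.2.4 (Schur for invariant forms).
-/

set_option autoImplicit false
set_option linter.dupNamespace false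

noncomputable section

open MeasureTheory NumberField
open scoped InnerProductSpace ENNReal ComplexOrder Matrix

namespace Summit.HodgeConjecture.HodgeConjecture.Cruxes.H413.F0P2aCohIsotypicLineHolds

open Literature.NumberTheory.Automorphic Literature.NumberTheory.Automorphic.UnitaryGroup
open Literature.NumberTheory.Automorphic.UnitaryGroup.CotangentForms (toQuotFun cmArchSection cmCompactFactor)
open Summit.HodgeConjecture.HodgeConjecture.Cruxes.H413.SpectrumJunction

/-! ## §1 Generic plumbing over any unitary datum `(F, E, c, N, J)`: `ContainsForm` algebra, coordinate class maps, unitarity -/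

section Generic

variable {F E : Type} [Field F] [NumberField F] [Field E] [NumberField E] [Algebra F E]
  {c : E ≃ₐ[F] E} {N : ℕ} {J : Matrix (Fin N) (Fin N) E}
  {μ : Measure (adelicGroupData F E c N J).automorphicQuotient}
  [(adelicGroupData F E c N J).IsAutomorphicMeasure μ]

/-- `⟪R(x) u, R(x) v⟫ = ⟪u, v⟫`: the regular representation preserves inner products (it is norm-preserving, ★
`AdelicGroupData.norm_rightRegular_apply`; Mathlib `LinearIsometry.inner_map_map`). [cite: BorelJacquet1979, §4.6] -/
theorem inner_rightRegular_rightRegular (x : (adelicGroupData F E c N J).Adelic) (u v : (adelicGroupData F E c N J).L2 μ) :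
    ⟪(adelicGroupData F E c N J).rightRegular μ x u, (adelicGroupData F E c N J).rightRegular μ x v⟫_ℂ = ⟪u, v⟫_ℂ :=
  let T : (adelicGroupData F E c N J).L2 μ →ₗᵢ[ℂ] (adelicGroupData F E c N J).L2 μ :=
    { toLinearMap := ((adelicGroupData F E c N J).rightRegular μ x :
          (adelicGroupData F E c N J).L2 μ →L[ℂ] (adelicGroupData F E c N J).L2 μ).toLinearMap
      norm_map' := (adelicGroupData F E c N J).norm_rightRegular_apply μ x }
  T.inner_map_map u v

/-- `P.ContainsForm` is stable under `Φ ↦ Φ - r • Ψ` (the classes of `P` form a submodule of `L²`). [cite: BorelJacquet1979, §4.6] -/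
theorem containsForm_sub_smul (P : DiscreteAutomorphicRep (adelicGroupData F E c N J) μ)
    {Φ Ψ : (adelicGroupData F E c N J).Adelic → (Fin 2 → ℂ)} (hΦ : P.ContainsForm Φ) (hΨ : P.ContainsForm Ψ) (r : ℂ) :
    P.ContainsForm (Φ - r • Ψ) := by
  intro j
  obtain ⟨h1, h1P⟩ := hΦ j
  obtain ⟨h2, h2P⟩ := hΨ j
  have hfun : (toQuotFun (adelicGroupData F E c N J) fun x => (Φ - r • Ψ) x j) =
      (toQuotFun (adelicGroupData F E c N J) fun x => Φ x j) - r • (toQuotFun (adelicGroupData F E c N J) fun x => Ψ x j) := by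
    funext y
    simp only [toQuotFun, Pi.sub_apply, Pi.smul_apply, smul_eq_mul]
  have hmem : MemLp (toQuotFun (adelicGroupData F E c N J) fun x => (Φ - r • Ψ) x j) 2 μ := by
    rw [hfun]
    exact h1.sub (h2.const_smul r)
  refine ⟨hmem, ?_⟩
  have heq : hmem.toLp (toQuotFun (adelicGroupData F E c N J) fun x => (Φ - r • Ψ) x j) =
      h1.toLp (toQuotFun (adelicGroupData F E c N J) fun x => Φ x j) -
        r • h2.toLp (toQuotFun (adelicGroupData F E c N J) fun x => Ψ x j) := by
    rw [← MemLp.toLp_const_smul, ← MemLp.toLp_sub]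
    exact MemLp.toLp_congr _ _ (Filter.EventuallyEq.of_eq hfun)
  rw [heq]
  exact P.space.toSubmodule.sub_mem h1P (P.space.toSubmodule.smul_mem r h2P)

/-- **Coordinate class maps.**  For a `σ`-equivariant linear `φ : W → (U(J)(𝔸) → ℂ²)` with left-invariant values contained in `P`, the two
maps `Λ j : w ↦ [toQuotFun (φ w · j)] ∈ L²` are LINEAR, valued in `P`, and intertwine `σ` with `R|_{U(J)(𝔸_f)}` (★ `toLp_toQuotFun_mul_right`);
the `MemLp` proof inside `toLp` is irrelevant.  (Pattern of ★ `SpectrumJunction.hasFinComponent_of_equivariant`.) [cite: BorelJacquet1979, §4.6] -/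
theorem exists_clsMaps (P : DiscreteAutomorphicRep (adelicGroupData F E c N J) μ)
    {W : Type} [AddCommGroup W] [Module ℂ W] (σ : Representation ℂ (finAdelic F E c N J) W)
    (φ : W →ₗ[ℂ] ((adelicGroupData F E c N J).Adelic → (Fin 2 → ℂ)))
    (hE : ∀ (g : finAdelic F E c N J) (w : W), φ (σ g w) = CotangentForms.rightRep F E c N J g (φ w))
    (hleft : ∀ w, ∀ γ ∈ (adelicGroupData F E c N J).quotientSubgroup, ∀ x, φ w (γ * x) = φ w x)
    (hP : ∀ w, P.ContainsForm (φ w)) :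
    ∃ Λ : Fin 2 → (W →ₗ[ℂ] (adelicGroupData F E c N J).L2 μ),
      (∀ (j : Fin 2) (w : W) (h : MemLp (toQuotFun (adelicGroupData F E c N J) fun x => φ w x j) 2 μ),
          Λ j w = h.toLp (toQuotFun (adelicGroupData F E c N J) fun x => φ w x j)) ∧
      (∀ (j : Fin 2) (w : W), Λ j w ∈ P.space.toSubmodule) ∧
      (∀ (j : Fin 2) (g : finAdelic F E c N J) (w : W),
          Λ j (σ g w) = (adelicGroupData F E c N J).rightRegular μ (finAdelicToAdelic F E c N J g) (Λ j w)) := by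
  have hmem : ∀ (w : W) (j : Fin 2), MemLp (toQuotFun (adelicGroupData F E c N J) fun x => φ w x j) 2 μ :=
    fun w j => ((hP w) j).choose
  have hmemP : ∀ (w : W) (j : Fin 2),
      (hmem w j).toLp (toQuotFun (adelicGroupData F E c N J) fun x => φ w x j) ∈ P.space.toSubmodule :=
    fun w j => ((hP w) j).choose_spec
  have hleftj : ∀ (w : W) (j : Fin 2), ∀ γ ∈ (adelicGroupData F E c N J).quotientSubgroup, ∀ x,
      (fun x => φ w x j) (γ * x) = (fun x => φ w x j) x :=
    fun w j γ hγ x => by simp only [hleft w γ hγ x]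
  let Λ : Fin 2 → (W →ₗ[ℂ] (adelicGroupData F E c N J).L2 μ) := fun j =>
    { toFun := fun w => (hmem w j).toLp (toQuotFun (adelicGroupData F E c N J) fun x => φ w x j)
      map_add' := fun w w' => by
        change (hmem (w + w') j).toLp _ = (hmem w j).toLp _ + (hmem w' j).toLp _
        rw [← MemLp.toLp_add]
        exact MemLp.toLp_congr _ _ (Filter.EventuallyEq.of_eq
          (funext fun y => by simp only [toQuotFun, map_add, Pi.add_apply]))
      map_smul' := fun r w => by
        change (hmem (r • w) j).toLp _ = r • (hmem w j).toLp _
        rw [← MemLp.toLp_const_smul]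
        exact MemLp.toLp_congr _ _ (Filter.EventuallyEq.of_eq
          (funext fun y => by simp only [toQuotFun, map_smul, Pi.smul_apply, smul_eq_mul])) }
  have hΛ : ∀ (j : Fin 2) (w : W),
      Λ j w = (hmem w j).toLp (toQuotFun (adelicGroupData F E c N J) fun x => φ w x j) := fun _ _ => rfl
  refine ⟨Λ, fun j w h => hΛ j w, fun j w => by rw [hΛ]; exact hmemP w j, fun j g w => ?_⟩
  rw [hΛ, hΛ]
  have hfun : (toQuotFun (adelicGroupData F E c N J) fun x => φ (σ g w) x j) =
      toQuotFun (adelicGroupData F E c N J) fun x => (fun y => φ w y j) (x * finAdelicToAdelic F E c N J g) := by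
    funext y
    simp only [toQuotFun, hE, CotangentForms.rightRep_apply]
  have hmemh : MemLp (toQuotFun (adelicGroupData F E c N J)
      fun x => (fun y => φ w y j) (x * finAdelicToAdelic F E c N J g)) 2 μ := hfun ▸ hmem (σ g w) j
  rw [show (hmem (σ g w) j).toLp _ = hmemh.toLp _ from MemLp.toLp_congr _ _ (Filter.EventuallyEq.of_eq hfun)]
  exact toLp_toQuotFun_mul_right (hleftj w j) _ (hmem w j) hmemh

/-- **THE BOOTSTRAP (generic).**  S1 (★ `F0P2aStubS1SesqSchur.stubS1_holds`) + the orthogonality-vanishing property of `A` relative to `P` ⇒ for `σ` irreducible admissible, any two `σ`-equivariant linear maps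
`ψ₁ ≠ 0`, `ψ` with values in `{Φ ∈ A ∣ P.ContainsForm Φ}` are proportional: `ψ = r • ψ₁`.  Steps (1)(2)(3) of the module docstring, then
`OrthVanish` applied to `N := range ψ₁` and `Φ₃ := (ψ - c • ψ₁) w'`. [cite: Liu2021, Lem. D.2 (2)] [cite: BorelWallach2000, VII 3.2] -/
theorem exists_eq_smul_of_orthVanish (P : DiscreteAutomorphicRep (adelicGroupData F E c N J) μ)
    (A : Submodule ℂ ((adelicGroupData F E c N J).Adelic → (Fin 2 → ℂ)))
    (hAleft : ∀ Φ ∈ A, ∀ γ ∈ (adelicGroupData F E c N J).quotientSubgroup, ∀ x, Φ (γ * x) = Φ x)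
    (hA : (∀ N' : Submodule ℂ ((adelicGroupData F E c N J).Adelic → (Fin 2 → ℂ)), N' ≤ A →
      (∀ Φ ∈ N', P.ContainsForm Φ) → (∀ (g : finAdelic F E c N J), ∀ Φ ∈ N', CotangentForms.rightRep F E c N J g Φ ∈ N') → N' ≠ ⊥ →
      ∀ Φ₃ ∈ A, P.ContainsForm Φ₃ →
      (∀ Φ ∈ N', ∀ (hΦ : ∀ j : Fin 2, MemLp (toQuotFun (adelicGroupData F E c N J) fun x => Φ x j) 2 μ)
          (h₃ : ∀ j : Fin 2, MemLp (toQuotFun (adelicGroupData F E c N J) fun x => Φ₃ x j) 2 μ),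
        ∑ j : Fin 2, ⟪(hΦ j).toLp (toQuotFun (adelicGroupData F E c N J) fun x => Φ x j),
          (h₃ j).toLp (toQuotFun (adelicGroupData F E c N J) fun x => Φ₃ x j)⟫_ℂ = 0) →
      Φ₃ = 0))
    {W : Type} [AddCommGroup W] [Module ℂ W] (σ : Representation ℂ (finAdelic F E c N J) W)
    (hirr : σ.IsIrreducible) (hadm : σ.IsAdmissible)
    (ψ₁ ψ : W →ₗ[ℂ] ((adelicGroupData F E c N J).Adelic → (Fin 2 → ℂ)))
    (hE₁ : ∀ (g : finAdelic F E c N J) (w : W), ψ₁ (σ g w) = CotangentForms.rightRep F E c N J g (ψ₁ w))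
    (hV₁ : ∀ w, ψ₁ w ∈ A ∧ P.ContainsForm (ψ₁ w)) (hne : ψ₁ ≠ 0)
    (hE : ∀ (g : finAdelic F E c N J) (w : W), ψ (σ g w) = CotangentForms.rightRep F E c N J g (ψ w))
    (hV : ∀ w, ψ w ∈ A ∧ P.ContainsForm (ψ w)) :
    ∃ r : ℂ, ψ = r • ψ₁ := by
  obtain ⟨Λ₁, hΛ₁, -, hΛ₁e⟩ := exists_clsMaps P σ ψ₁ hE₁ (fun w => hAleft _ (hV₁ w).1) (fun w => (hV₁ w).2)
  obtain ⟨Λ, hΛ, -, hΛe⟩ := exists_clsMaps P σ ψ hE (fun w => hAleft _ (hV w).1) (fun w => (hV w).2)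
  -- (1) the maps into the Hilbert sum `L² ⊕ L²`
  let φ₁ : W →ₗ[ℂ] PiLp 2 (fun _ : Fin 2 => (adelicGroupData F E c N J).L2 μ) :=
    (WithLp.linearEquiv 2 ℂ (Fin 2 → (adelicGroupData F E c N J).L2 μ)).symm.toLinearMap ∘ₗ LinearMap.pi fun j => Λ₁ j
  let φ₂ : W →ₗ[ℂ] PiLp 2 (fun _ : Fin 2 => (adelicGroupData F E c N J).L2 μ) :=
    (WithLp.linearEquiv 2 ℂ (Fin 2 → (adelicGroupData F E c N J).L2 μ)).symm.toLinearMap ∘ₗ LinearMap.pi fun j => Λ j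
  have hφ₁ : ∀ (w : W) (j : Fin 2), φ₁ w j = Λ₁ j w := fun _ _ => rfl
  have hφ₂ : ∀ (w : W) (j : Fin 2), φ₂ w j = Λ j w := fun _ _ => rfl
  have hin : ∀ x y : PiLp 2 (fun _ : Fin 2 => (adelicGroupData F E c N J).L2 μ), ⟪x, y⟫_ℂ = ∑ j, ⟪x j, y j⟫_ℂ :=
    fun x y => PiLp.inner_apply x y
  have hb₁ : ∀ (g : finAdelic F E c N J) (w w' : W), ⟪φ₁ (σ g w), φ₁ (σ g w')⟫_ℂ = ⟪φ₁ w, φ₁ w'⟫_ℂ := by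
    intro g w w'
    rw [hin, hin]
    refine Finset.sum_congr rfl fun j _ => ?_
    rw [hφ₁, hφ₁, hφ₁, hφ₁, hΛ₁e, hΛ₁e, inner_rightRegular_rightRegular]
  have hb₂ : ∀ (g : finAdelic F E c N J) (w w' : W), ⟪φ₁ (σ g w), φ₂ (σ g w')⟫_ℂ = ⟪φ₁ w, φ₂ w'⟫_ℂ := by
    intro g w w'
    rw [hin, hin]
    refine Finset.sum_congr rfl fun j _ => ?_
    rw [hφ₁, hφ₁, hφ₂, hφ₂, hΛ₁e, hΛe, inner_rightRegular_rightRegular]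
  -- a compact open subgroup of `U(J)(𝔸_f)`: the integral congruence level
  have hK : ∃ K₀ : OpenSubgroup (finAdelic F E c N J), IsCompact (K₀ : Set (finAdelic F E c N J)) :=
    ⟨⟨finCongruenceLevel F E c N J ⊤, (isCompact_isOpen_finCongruenceLevel_top F E c N J).2⟩,
      (isCompact_isOpen_finCongruenceLevel_top F E c N J).1⟩
  -- (2) Schur for invariant sesquilinear forms
  obtain ⟨c₀, hc₀⟩ := F0P2aStubS1SesqSchur.stubS1_holds (finAdelic F E c N J) W σ hirr hadm hK _ φ₁ φ₂ hb₁ hb₂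
  -- (3) the corrected map `ψ - c₀ • ψ₁`
  have hE₃ : ∀ (g : finAdelic F E c N J) (w : W), (ψ - c₀ • ψ₁) (σ g w) = CotangentForms.rightRep F E c N J g ((ψ - c₀ • ψ₁) w) := by
    intro g w
    simp only [LinearMap.sub_apply, LinearMap.smul_apply, hE, hE₁, map_sub, map_smul]
  have hV₃ : ∀ w, (ψ - c₀ • ψ₁) w ∈ A ∧ P.ContainsForm ((ψ - c₀ • ψ₁) w) := fun w =>
    ⟨A.sub_mem (hV w).1 (A.smul_mem c₀ (hV₁ w).1), by
      simpa only [LinearMap.sub_apply, LinearMap.smul_apply] using containsForm_sub_smul P (hV w).2 (hV₁ w).2 c₀⟩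
  obtain ⟨Λ₃, hΛ₃, -, -⟩ := exists_clsMaps P σ (ψ - c₀ • ψ₁) hE₃ (fun w => hAleft _ (hV₃ w).1) (fun w => (hV₃ w).2)
  have hΛ₃eq : ∀ (j : Fin 2) (w' : W), Λ₃ j w' = Λ j w' - c₀ • Λ₁ j w' := by
    intro j w'
    have h1 : MemLp (toQuotFun (adelicGroupData F E c N J) fun x => ψ w' x j) 2 μ := ((hV w').2 j).choose
    have h2 : MemLp (toQuotFun (adelicGroupData F E c N J) fun x => ψ₁ w' x j) 2 μ := ((hV₁ w').2 j).choose
    have hfun : (toQuotFun (adelicGroupData F E c N J) fun x => (ψ - c₀ • ψ₁) w' x j) =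
        (toQuotFun (adelicGroupData F E c N J) fun x => ψ w' x j) -
          c₀ • (toQuotFun (adelicGroupData F E c N J) fun x => ψ₁ w' x j) := by
      funext y
      simp only [toQuotFun, LinearMap.sub_apply, LinearMap.smul_apply, Pi.sub_apply, Pi.smul_apply, smul_eq_mul]
    have h3 : MemLp (toQuotFun (adelicGroupData F E c N J) fun x => (ψ - c₀ • ψ₁) w' x j) 2 μ := by
      rw [hfun]
      exact h1.sub (h2.const_smul c₀)
    rw [hΛ₃ j w' h3, hΛ j w' h1, hΛ₁ j w' h2, ← MemLp.toLp_const_smul, ← MemLp.toLp_sub]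
    exact MemLp.toLp_congr _ _ (Filter.EventuallyEq.of_eq hfun)
  have horth : ∀ w w' : W, ∑ j : Fin 2, ⟪Λ₁ j w, Λ₃ j w'⟫_ℂ = 0 := by
    intro w w'
    have h := hc₀ w w'
    rw [hin, hin, Finset.mul_sum] at h
    rw [← sub_eq_zero, ← Finset.sum_sub_distrib] at h
    rw [← h]
    refine Finset.sum_congr rfl fun j _ => ?_
    simp only [hφ₁, hφ₂, hΛ₃eq, inner_sub_right, inner_smul_right]
  -- (4)+(5) `OrthVanish` on `N := range ψ₁`, `Φ₃ := (ψ - c₀ • ψ₁) w'`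
  have hzero : ∀ w' : W, (ψ - c₀ • ψ₁) w' = 0 := by
    intro w'
    refine hA (LinearMap.range ψ₁) ?_ ?_ ?_ ?_ ((ψ - c₀ • ψ₁) w') (hV₃ w').1 (hV₃ w').2 ?_
    · rintro _ ⟨w, rfl⟩
      exact (hV₁ w).1
    · rintro _ ⟨w, rfl⟩
      exact (hV₁ w).2
    · rintro g _ ⟨w, rfl⟩
      exact LinearMap.mem_range.mpr ⟨σ g w, hE₁ g w⟩
    · intro h0
      exact hne (LinearMap.range_eq_bot.mp h0)
    · rintro _ ⟨w, rfl⟩ hΦ h₃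
      calc ∑ j : Fin 2, ⟪(hΦ j).toLp (toQuotFun (adelicGroupData F E c N J) fun x => ψ₁ w x j),
              (h₃ j).toLp (toQuotFun (adelicGroupData F E c N J) fun x => (ψ - c₀ • ψ₁) w' x j)⟫_ℂ
            = ∑ j : Fin 2, ⟪Λ₁ j w, Λ₃ j w'⟫_ℂ :=
              Finset.sum_congr rfl fun j _ => by rw [← hΛ₁ j w (hΦ j), ← hΛ₃ j w' (h₃ j)]
        _ = 0 := horth w w'
  have hψ : ψ - c₀ • ψ₁ = 0 := LinearMap.ext hzero
  exact ⟨c₀, sub_eq_zero.mp hψ⟩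

end Generic

end Summit.HodgeConjecture.HodgeConjecture.Cruxes.H413.F0P2aCohIsotypicLineHolds

end
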